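import Summits.NavierStokesRegularity.NavierStokesRegularity.Theorems.ExtremiserTransienceNearExtremalTransienceExtremiserLiouvilleConstantSpeedSlideQuotient
import HarnessLib

/-!
# Crux `ExtremiserTransience.NearExtremalTransience` (stmt-NavierStokesRegularity-21883), line `extremiser_liouville`,
# stub K1b — differentiating VECTOR-valued vertical sliding integrals (record §13, R2–R4 tool)

`--supports stmt-NavierStokesRegularity-21883` (helper).  Author: prover seat `ns-el-k1b` (g8).  `…SlideQuotient` /
`…SlideQuotientBounds` differentiate the scalar sliding integral `∫_{−h}^{0}G(· + te₂)dt`; the palinstrophy bound needs the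
same for vector- and operator-valued integrands (`K = DG`, `K = D²G`):
* `differentiable_verticalIntegral'`, `fderiv_verticalIntegral_eq'` : for `K : ℝ³ → F` of class `C¹` (`F` complete),
  **`D(∫_{a}^{b}K(· + te₂)dt)(x) = ∫_{a}^{b}DK(x + te₂)dt`**;
* `fderiv_verticalIntegral_apply'` : applied to a vector, `D(∫K(·+te₂)dt)(x)v = ∫DK(x+te₂)v dt`.

WHAT THIS IS NOT: K1b is NOT proved; nothing here proves NS regularity. [folklore]
-/

noncomputable section

open Set Filter Topology MeasureTheory Metric Function InnerProductSpace
open scoped ENNReal NNReal Topology InnerProductSpace RealInnerProductSpace ContDiff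
open Literature.Analysis.FluidPDE Literature.Analysis

namespace Summit.NavierStokesRegularity.NavierStokesRegularity.Theorems

-- the problem directory repeats the summit name (`NavierStokesRegularity/NavierStokesRegularity`)
set_option linter.dupNamespace false

namespace ExtremiserLiouville

variable {F' : Type*} [NormedAddCommGroup F'] [NormedSpace ℝ F']

/-- The integrand `(y, t) ↦ K(y + te₂)` is `Cⁿ` when `K` is. [folklore] -/
theorem contDiff_uncurry_comp_add_smul' {K : EuclideanSpace ℝ (Fin 3) → F'} {n : WithTop ℕ∞} (hK : ContDiff ℝ n K) :
    ContDiff ℝ n (uncurry fun (y : EuclideanSpace ℝ (Fin 3)) (t : ℝ) =>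
      K (y + t • EuclideanSpace.single (2 : Fin 3) (1 : ℝ))) :=
  hK.comp (contDiff_fst.add (contDiff_snd.smul contDiff_const))

/-- The sliding integral of a `C¹` vector-valued map is differentiable. [folklore] -/
theorem differentiable_verticalIntegral' {K : EuclideanSpace ℝ (Fin 3) → F'} (hK : ContDiff ℝ 1 K) (a b : ℝ) :
    Differentiable ℝ fun y : EuclideanSpace ℝ (Fin 3) =>
      ∫ t in a..b, K (y + t • EuclideanSpace.single (2 : Fin 3) (1 : ℝ)) := fun y =>
  (Literature.Analysis.Calculus.hasFDerivAt_intervalIntegral_partialFDerivFst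
    (contDiff_uncurry_comp_add_smul' hK) one_ne_zero a b y).differentiableAt

/-- **Differentiation under the vertical sliding integral** (vector-valued): for `K ∈ C¹`,
`D(∫_{a}^{b}K(· + te₂)dt)(x) = ∫_{a}^{b}DK(x + te₂)dt`. [folklore] -/
theorem fderiv_verticalIntegral_eq' {K : EuclideanSpace ℝ (Fin 3) → F'} (hK : ContDiff ℝ 1 K) (a b : ℝ)
    (x : EuclideanSpace ℝ (Fin 3)) :
    fderiv ℝ (fun y : EuclideanSpace ℝ (Fin 3) => ∫ t in a..b, K (y + t • EuclideanSpace.single (2 : Fin 3) (1 : ℝ))) x =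
      ∫ t in a..b, fderiv ℝ K (x + t • EuclideanSpace.single (2 : Fin 3) (1 : ℝ)) := by
  set e₂ : EuclideanSpace ℝ (Fin 3) := EuclideanSpace.single (2 : Fin 3) (1 : ℝ) with he₂
  have hF := contDiff_uncurry_comp_add_smul' hK
  rw [Literature.Analysis.Calculus.fderiv_intervalIntegral_eq_partialFDerivFst hF one_ne_zero a b]
  refine intervalIntegral.integral_congr fun t _ => ?_
  show Literature.Analysis.Calculus.partialFDerivFst (fun (y : EuclideanSpace ℝ (Fin 3)) (t : ℝ) => K (y + t • e₂)) x t =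
    fderiv ℝ K (x + t • e₂)
  rw [← Literature.Analysis.Calculus.fderiv_eq_partialFDerivFst hF one_ne_zero x t]
  show fderiv ℝ (fun y : EuclideanSpace ℝ (Fin 3) => K (y + t • e₂)) x = fderiv ℝ K (x + t • e₂)
  rw [fderiv_comp_add_right]

/-- Applied form: `D(∫_{a}^{b}K(· + te₂)dt)(x)·v = ∫_{a}^{b}DK(x + te₂)·v dt`. [folklore] -/
theorem fderiv_verticalIntegral_apply' [CompleteSpace F'] {K : EuclideanSpace ℝ (Fin 3) → F'} (hK : ContDiff ℝ 1 K) (a b : ℝ)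
    (x v : EuclideanSpace ℝ (Fin 3)) :
    fderiv ℝ (fun y : EuclideanSpace ℝ (Fin 3) => ∫ t in a..b, K (y + t • EuclideanSpace.single (2 : Fin 3) (1 : ℝ))) x v =
      ∫ t in a..b, fderiv ℝ K (x + t • EuclideanSpace.single (2 : Fin 3) (1 : ℝ)) v := by
  rw [fderiv_verticalIntegral_eq' hK a b x]
  have hc : Continuous fun t : ℝ => fderiv ℝ K (x + t • EuclideanSpace.single (2 : Fin 3) (1 : ℝ)) :=
    (hK.continuous_fderiv one_ne_zero).comp (continuous_const.add (continuous_id.smul continuous_const))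
  exact ContinuousLinearMap.intervalIntegral_apply (hc.intervalIntegrable _ _) v

end ExtremiserLiouville

end Summit.NavierStokesRegularity.NavierStokesRegularity.Theorems

end
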